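import Mathlib
import Literature.MathematicalPhysics.QuantumLattice.GrassmannIntegral

/-!
# Cell-pressure certificate of the static route — definitions (real side)
(crux stmt-QuantumFields-9734, line `Sketch`, stub `stub_heavyFrequencyGain`, Route B step B6; lead c3)

For the 2D frequency operator `D = N_ω ⊗ 1 − H` at a HEAVY frequency (on-site spin block
`N = M·1 + i(s₀γ₀ + s₁γ₁)`, `M = m + 4 − cos ω₀ − cos ω₁ ∈ [5.89, 6.1]`, `s_i = sin ω_i`, `ρ² = M² + s₀² + s₁²`), the gain per
unit plaquette deficit of the doubly 2-periodic reflection tiling of one plaquette `P` is, to second order in `P − 1`,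
`κ ≥ κ₁ − b` where (S4-PLAN.md §B6):

* `κ₁ = −Re tr[g(e₂) P₋²]` is the TADPOLE coefficient: `g(z) = Σ_j F_j(z)` the spin part of the free propagator between lattice
  points at displacement `z`, `F_j(z) = [(N⁻¹h)^j N⁻¹](z, 0)` the sum over planar nearest-neighbour walks of length `j` with
  the Wilson spin weights (`P∓^μ = ½(1 ∓ γ_μ)`, `μ = 2, 3`), given by the recursion `planarWalk`;
* `b` is the ABSOLUTE BUBBLE bound: a finite sum over pairs (cell link, nearby link) of `|tr_spin(g B₁ g B₂)|` with the
  first-order hop blocks `B ∈ {∓P₋², ±P₊²}` of the checkerboard links.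

This file defines the truncated quantities `kappaOne J`, `bubbleAbs J R` (planar walks of length `≤ J`, partner links within
`ℓ¹`-distance `R`), the truncation tails, and the CERTIFIED CLAIM `CellKappaClaim` (a closed real inequality on the box
`M ∈ [589/100, 61/10]`, `|s₀|, |s₁| ≤ 1/10` — the heavy set `cos ω_i ≤ −199/200`, `|m| ≤ 1/10`), proved in the certificate
file by validated affine arithmetic.
All objects are explicit `4 × 4` complex matrices; nothing here refers to lattices or determinants (the analytic cell
lemma imports these definitions).
-/

noncomputable section

open scoped BigOperators Matrix ComplexConjugate
open Matrix Literature.MathematicalPhysics.QuantumLattice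

namespace Summit.QuantumFields.QCD.Cruxes.CriticalLineDiamagnetism.ChessboardCellGain.CellKappa

/-- The inverse on-site spin block `N⁻¹ = (M·1 − i(s₀γ₀ + s₁γ₁)) / ρ²`, `ρ² = M² + s₀² + s₁²`. -/
def nInv (M s₀ s₁ : ℝ) : Matrix (Fin 4) (Fin 4) ℂ :=
  ((1 / (M ^ 2 + s₀ ^ 2 + s₁ ^ 2) : ℝ) : ℂ) •
    (((M : ℝ) : ℂ) • (1 : Matrix (Fin 4) (Fin 4) ℂ) -
      Complex.I • ((((s₀ : ℝ) : ℂ)) • euclideanGamma 0 + ((s₁ : ℝ) : ℂ) • euclideanGamma 1))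

/-- The Wilson projection `P₋^μ = ½(1 − γ_μ)`. -/
def pMinus (μ : Fin 4) : Matrix (Fin 4) (Fin 4) ℂ := (1 / 2 : ℂ) • (1 - euclideanGamma μ)

/-- The Wilson projection `P₊^μ = ½(1 + γ_μ)`. -/
def pPlus (μ : Fin 4) : Matrix (Fin 4) (Fin 4) ℂ := (1 / 2 : ℂ) • (1 + euclideanGamma μ)

/-- The four steps of a planar walk: displacement of the NEXT point read backwards and its spin weight
(`F_{j+1}(z) = N⁻¹ [P₋² F_j(z + e₂) + P₊² F_j(z − e₂) + P₋³ F_j(z + e₃) + P₊³ F_j(z − e₃)]`). -/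
def steps : List ((ℤ × ℤ) × Matrix (Fin 4) (Fin 4) ℂ) :=
  [((1, 0), pMinus 2), ((-1, 0), pPlus 2), ((0, 1), pMinus 3), ((0, -1), pPlus 3)]

/-- Planar walk sums `F_j(z) = [(N⁻¹h)^j N⁻¹](z, 0)`: spin weight of all nearest-neighbour walks of length `j` on `ℤ²`
from the origin to `z`, by recursion on `j`. -/
def planarWalk (M s₀ s₁ : ℝ) : ℕ → ℤ × ℤ → Matrix (Fin 4) (Fin 4) ℂ
  | 0, z => if z = (0, 0) then nInv M s₀ s₁ else 0
  | j + 1, z => nInv M s₀ s₁ *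
      (steps.map fun sd => sd.2 * planarWalk M s₀ s₁ j (z.1 + sd.1.1, z.2 + sd.1.2)).sum

/-- The truncated free spin propagator `g_J(z) = Σ_{j ≤ J} F_j(z)`. -/
def propTrunc (M s₀ s₁ : ℝ) (J : ℕ) (z : ℤ × ℤ) : Matrix (Fin 4) (Fin 4) ℂ :=
  ((List.range (J + 1)).map fun j => planarWalk M s₀ s₁ j z).sum

/-- The truncated TADPOLE coefficient `κ₁,J = −Re tr[g_J(e₂) P₋²]`. -/
def kappaOne (M s₀ s₁ : ℝ) (J : ℕ) : ℝ :=
  -((propTrunc M s₀ s₁ J (1, 0) * pMinus 2).trace).re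

/-- The two first-order hop blocks of the checkerboard link based at `(a, b)` (`b` odd; sign `(−1)^a`):
`(z, x, B)` with `Δ′(z, x) = B`: `((a,b), (a+1,b), −σ P₋²)` and `((a+1,b), (a,b), σ P₊²)`. -/
def linkBlocks (l : ℤ × ℤ) : List ((ℤ × ℤ) × (ℤ × ℤ) × Matrix (Fin 4) (Fin 4) ℂ) :=
  let σ : ℂ := if l.1 % 2 = 0 then 1 else -1
  [((l.1, l.2), (l.1 + 1, l.2), (-σ) • pMinus 2), ((l.1 + 1, l.2), (l.1, l.2), σ • pPlus 2)]

/-- The two checkerboard links of the unit cell `[0,2) × [0,2)`: bases `(0,1)` and `(1,1)`. -/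
def cellLinks : List (ℤ × ℤ) := [(0, 1), (1, 1)]

/-- The partner links of a cell link within `ℓ¹`-distance `R`: bases `(a, b)` with `b` odd. -/
def nearLinks (R : ℕ) (l : ℤ × ℤ) : List (ℤ × ℤ) :=
  ((List.range (2 * R + 1)).flatMap fun i => (List.range (2 * R + 1)).filterMap fun k =>
    let a : ℤ := l.1 + i - R
    let b : ℤ := l.2 + k - R
    if b % 2 ≠ 0 ∧ |a - l.1| + |b - l.2| ≤ R then some (a, b) else none)

/-- The truncated ABSOLUTE BUBBLE bound
`b_{J,R} = ¼ Σ_{ℓ ∈ cell} Σ_{(z₂,x₁,B₂) ∈ blocks ℓ} Σ_{ℓ′ near ℓ} Σ_{(z₁,x₂,B₁) ∈ blocks ℓ′} |tr(g_J(x₁−z₁) B₁ g_J(x₂−z₂) B₂)|`. -/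
def bubbleAbs (M s₀ s₁ : ℝ) (J R : ℕ) : ℝ :=
  (1 / 4 : ℝ) * (cellLinks.map fun l => ((linkBlocks l).map fun zb₂ =>
    ((nearLinks R l).map fun l' => ((linkBlocks l').map fun zb₁ =>
      ‖(propTrunc M s₀ s₁ J (zb₂.2.1.1 - zb₁.1.1, zb₂.2.1.2 - zb₁.1.2) * zb₁.2.2 *
          propTrunc M s₀ s₁ J (zb₁.2.1.1 - zb₂.1.1, zb₁.2.1.2 - zb₂.1.2) * zb₂.2.2).trace‖).sum).sum).sum).sum

/-- `ρ = (M² + s₀² + s₁²)^{1/2}`. -/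
def rho (M s₀ s₁ : ℝ) : ℝ := Real.sqrt (M ^ 2 + s₀ ^ 2 + s₁ ^ 2)

/-- Operator-norm tail of the truncated propagator: `‖g − g_J‖ ≤ τ_J = (2/ρ)^{J+1} / (ρ − 2)`. -/
def tailProp (M s₀ s₁ : ℝ) (J : ℕ) : ℝ := (2 / rho M s₀ s₁) ^ (J + 1) / (rho M s₀ s₁ - 2)

/-- Walk-length decay bound of the free propagator at `ℓ¹`-distance `≥ d`: `G(d) = (2/ρ)^d / (ρ − 2)`. -/
def decayProp (M s₀ s₁ : ℝ) (d : ℕ) : ℝ := (2 / rho M s₀ s₁) ^ d / (rho M s₀ s₁ - 2)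

/-- The far-pair tail of the bubble bound: partner links at `ℓ¹`-distance `d > R` (at most `4d` of them, `2 × 2` block
choices, two cell links, each term `≤ 2 G(d−1)²`), summed as the finite sum up to `dmax` plus nothing beyond (the
certificate chooses `dmax` with a separate closed-form geometric remainder `farRemainder`). -/
def farPairs (M s₀ s₁ : ℝ) (R dmax : ℕ) : ℝ :=
  (1 / 4 : ℝ) * ((List.range dmax).map fun d =>
    if R < d then (2 : ℝ) * (4 * d) * 4 * (2 * decayProp M s₀ s₁ (d - 1) ^ 2) else 0).sum

/-- **The certified claim** (discharged by validated affine arithmetic in `…CellKappaCert`): on the heavy box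
`M ∈ [5.89, 6.1]` (i.e. `|m| ≤ 1/10`, `cos ω_i ≤ −199/200`), `|s_i| ≤ 1/10`, the truncated tadpole beats the truncated absolute
bubble bound by `1/4000` per unit deficit, with `J = 14` (walk length) and `R = 7` (partner distance).  The truncation tails
(`tailProp`, `decayProp`, `farPairs`: all `< 10⁻⁵` here since `2/ρ ≤ 0.34`) are added analytically in the cell lemma. -/
def CellKappaClaim : Prop :=
  ∀ (M s₀ s₁ : ℝ), 589 / 100 ≤ M → M ≤ 61 / 10 → |s₀| ≤ 1 / 10 → |s₁| ≤ 1 / 10 →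
    1 / 4000 ≤ kappaOne M s₀ s₁ 14 - bubbleAbs M s₀ s₁ 14 7

/-- Registered anchor theorem of this definitions file: the two Wilson projections of a slot add up to the identity. -/
theorem cellKappaDefs_anchor : ∀ μ : Fin 4, (1 / 2 : ℂ) • ((1 : Matrix (Fin 4) (Fin 4) ℂ) - euclideanGamma μ) + (1 / 2 : ℂ) • ((1 : Matrix (Fin 4) (Fin 4) ℂ) + euclideanGamma μ) = 1 := by
  intro μ
  rw [← smul_add, sub_add_add_cancel, ← two_smul ℂ, smul_smul]
  norm_num

end Summit.QuantumFields.QCD.Cruxes.CriticalLineDiamagnetism.ChessboardCellGain.CellKappa
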